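import Literature.NumberTheory.CubicFields.ShintaniDualDensity
import Literature.NumberTheory.CubicFields.SingularZeroTransport
import HarnessLib

/-!
# The Fourier transform of `Ψ_{p²} = 𝟙_{p² ∣ Disc}` on `V(ℤ/p²ℤ)`: the fibre decomposition and the normal form
(towards Bhargava–Taniguchi–Thorne 2023, Prop. 5.2, second definition of `Ψ_{p²}`, `p ≥ 5`)

Topic `Literature/NumberTheory/CubicFields`; built on `ShintaniDualDensity.lean` (Shintani's pairing
`dualPairing`, `eMod`, the Fourier transform `fourierDual` of (eq:FT)) and `SingularZeroTransport.lean`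
(`V(R) ≃ R⁴`, finiteness). Everything in this file is PROVED; the only definitions are explicit finite
objects (the local sieve weight `psiLocal`, lifts `ℤ/p → ℤ/p²`, the gradient of `Disc`).

Bhargava–Taniguchi–Thorne 2023, §5: "we write `Ψ_{p²} : V(ℤ/p²ℤ) → {0, 1}` for the characteristic function
of … those `x ∈ V(ℤ/p²ℤ)` that are nonmaximal at `p` or have a triple root (mod `p`). When `p > 2`, this is
equivalent to requiring that `p² ∣ Disc(x)`", and Prop. 5.2 evaluates/bounds its Fourier transform
`Ψ̂_{p²}` case by case (citing Taniguchi–Thorne, *Orbital L-functions* / *Secondary terms*, where all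
`GL₂`-invariant functions mod `p²` are transformed). Here we give a direct, self-contained evaluation for
`p ≥ 5`, organised as follows (write `y = ỹ₀ + p z̃` with `y₀, z ∈ V(𝔽_p)` lifted by least residues):

* `BinaryCubic.disc_addMul`, `disc_decomp` — **`Disc(ỹ₀ + p z̃) = Disc(ỹ₀) + p·⟨∇Disc(ỹ₀), z̃⟩` in
  `ℤ/p²ℤ`** (Taylor to first order with explicit remainder, `p² = 0`); `BinaryCubic.dot_grad_self` — Euler's
  identity `a∂_a + b∂_b + c∂_c + d∂_d = 4 Disc`;
* `sum_decomp` — `Σ_{y ∈ V(ℤ/p²)} F(y) = Σ_{y₀} Σ_{z} F(ỹ₀ + p z̃)` (the fibre decomposition is a bijection);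
* `disc_decomp_eq_zero_iff` — `p² ∣ Disc(ỹ₀ + p z̃)` iff `Disc(y₀) = 0` in `𝔽_p` and
  `D₁(y₀) + ⟨∇Disc(y₀), z⟩ = 0` in `𝔽_p` (`D₁ = Disc(ỹ₀)/p mod p`, `divP`);
* `sum_psiLocal_mul_eMod`, `fourierDual_psiLocal_eq` — hence `p⁸ Ψ̂_{p²}(f) = Σ_{y₀} e(⟨f, ỹ₀⟩/p²) · Z_f(y₀)`
  with the FIBRE SUM (`fibreSum`) `Z_f(y₀) = [Disc y₀ = 0] Σ_{z ∈ V(𝔽_p)} [D₁(y₀) + ⟨∇Disc(y₀), z⟩ = 0] e(⟨f, z⟩/p)`;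
* `hyperSum_eq_zero_of_shift` — the hyperplane lemma: `Z_f(y₀) = 0` as soon as some `v` has
  `⟨∇Disc(y₀), v⟩ = 0` but `⟨f, v⟩ ≢ 0 (mod p)` (shift `z ↦ z + v`); `sum_eMod_mul`, `eMod_eq_one_iff`,
  `eMod_p_mul` — orthogonality and `e(pt/p²) = e(t/p)`;
* **`fourierDual_psiLocal_normalForm`** — for `f` in the NORMAL FORM `p ∣ a, b, c`, `p ∤ d` (the dual
  vector `ι⁻¹ f` pairs, mod `p`, through the coefficient `y_a` only): by Euler's identity
  `a ∂_a + b ∂_b + c ∂_c + d ∂_d = 4·Disc` only the `y₀ = (0, 0, c₀, d₀)`, `c₀ ≠ 0`, contribute, each with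
  `Z = p³`, and two geometric sums give
  `Ψ̂_{p²}(f) = [p² ∣ a] · (p⁻³ [p² ∣ b] − p⁻⁴)`.
  In particular `|Ψ̂_{p²}(f)| ≤ p⁻³`, `= p⁻⁴` exactly when `p² ∣ a`, `p ∥ b` (then `p³ ∥ Disc f`), and `= 0`
  when `p ∥ a` (then `p² ∥ Disc f`) — the last three bullets of BTT Prop. 5.2 for this definition of `Ψ`.

The reduction of an arbitrary primitive `f` to the normal form (vanishing unless `f mod p` is a cube
`μ ℓ³`, transport of the triple root to `(1 : 0)`) and the case `p ∣ f` are in the sequel files.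

## References

* M. Bhargava, T. Taniguchi, F. Thorne, *Improved error estimates for the Davenport–Heilbronn theorems*,
  Math. Ann. 389 (2024) = arXiv:2107.12819, §5, Prop. 5.2 [BhargavaTaniguchiThorne2023].
* T. Taniguchi, F. Thorne, *Secondary terms in counting functions for cubic fields*, Duke Math. J. 162
  (2013), Lemmas 3.3, 4.3 (the source of Prop. 5.2) [TaniguchiThorne2013].
-/

noncomputable section

open Complex Finset
open Literature.NumberTheory.CubicFields.BinaryCubic

namespace Literature.NumberTheory.CubicFields

namespace BinaryCubic

variable {R : Type*} [CommRing R]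

/-! ### The gradient of `Disc` and the first-order Taylor formula -/

/-- `∂Disc/∂a = −4c³ + 18bcd − 54ad²`. [folklore] -/
def discDa (y : BinaryCubic R) : R := -4 * y.c ^ 3 + 18 * y.b * y.c * y.d - 54 * y.a * y.d ^ 2

/-- `∂Disc/∂b = 2bc² − 12b²d + 18acd`. [folklore] -/
def discDb (y : BinaryCubic R) : R := 2 * y.b * y.c ^ 2 - 12 * y.b ^ 2 * y.d + 18 * y.a * y.c * y.d

/-- `∂Disc/∂c = 2b²c − 12ac² + 18abd`. [folklore] -/
def discDc (y : BinaryCubic R) : R := 2 * y.b ^ 2 * y.c - 12 * y.a * y.c ^ 2 + 18 * y.a * y.b * y.d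

/-- `∂Disc/∂d = −4b³ + 18abc − 54a²d`. [folklore] -/
def discDd (y : BinaryCubic R) : R := -4 * y.b ^ 3 + 18 * y.a * y.b * y.c - 54 * y.a ^ 2 * y.d

/-- The coefficientwise dot product `⟨L, z⟩ = L_a z_a + L_b z_b + L_c z_c + L_d z_d` on `V(R) ≅ R⁴`. [folklore] -/
def dot (L z : BinaryCubic R) : R := L.a * z.a + L.b * z.b + L.c * z.c + L.d * z.d

/-- The gradient `∇Disc(y)` as a coefficient vector. [folklore] -/
def grad (y : BinaryCubic R) : BinaryCubic R := ⟨y.discDa, y.discDb, y.discDc, y.discDd⟩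

/-- `⟨∇Disc(y), z⟩ = Σ_i ∂_i Disc(y) z_i`. [folklore] -/
theorem dot_grad (y z : BinaryCubic R) :
    dot (grad y) z = y.discDa * z.a + y.discDb * z.b + y.discDc * z.c + y.discDd * z.d := rfl

/-- **Euler's identity** for the quartic form `Disc`: `a ∂_a + b ∂_b + c ∂_c + d ∂_d = 4 Disc`. [folklore] -/
theorem dot_grad_self (y : BinaryCubic R) : dot (grad y) y = 4 * y.disc := by
  simp only [dot_grad, discDa, discDb, discDc, discDd, disc_eq]; ring

/-- The translate `y + P z` (coefficientwise). [folklore] -/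
def addMul (y : BinaryCubic R) (P : R) (z : BinaryCubic R) : BinaryCubic R :=
  ⟨y.a + P * z.a, y.b + P * z.b, y.c + P * z.c, y.d + P * z.d⟩

/-- Coefficient `a` of `y + P z`. [folklore] -/
@[simp] theorem addMul_a (y z : BinaryCubic R) (P : R) : (addMul y P z).a = y.a + P * z.a := rfl

/-- Coefficient `b` of `y + P z`. [folklore] -/
@[simp] theorem addMul_b (y z : BinaryCubic R) (P : R) : (addMul y P z).b = y.b + P * z.b := rfl

/-- Coefficient `c` of `y + P z`. [folklore] -/
@[simp] theorem addMul_c (y z : BinaryCubic R) (P : R) : (addMul y P z).c = y.c + P * z.c := rfl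

/-- Coefficient `d` of `y + P z`. [folklore] -/
@[simp] theorem addMul_d (y z : BinaryCubic R) (P : R) : (addMul y P z).d = y.d + P * z.d := rfl

/-- **Taylor's formula to first order with explicit remainder**:
`Disc(y + P z) = Disc(y) + P ⟨∇Disc(y), z⟩ + P² · R(y, z, P)`. [folklore] -/
theorem disc_addMul (y z : BinaryCubic R) (P : R) :
    (addMul y P z).disc = y.disc + P * dot (grad y) z + P ^ 2 *
      (z.b ^ 2 * z.c ^ 2 * P ^ 2 + -4 * z.b ^ 3 * z.d * P ^ 2 + -4 * z.a * z.c ^ 3 * P ^ 2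
        + 18 * z.a * z.b * z.c * z.d * P ^ 2 + -27 * z.a ^ 2 * z.d ^ 2 * P ^ 2 + -4 * y.d * z.b ^ 3 * P
        + 18 * y.d * z.a * z.b * z.c * P + -54 * y.d * z.a ^ 2 * z.d * P + 2 * y.c * z.b ^ 2 * z.c * P
        + -12 * y.c * z.a * z.c ^ 2 * P + 18 * y.c * z.a * z.b * z.d * P + 2 * y.b * z.b * z.c ^ 2 * P
        + -12 * y.b * z.b ^ 2 * z.d * P + 18 * y.b * z.a * z.c * z.d * P + -4 * y.a * z.c ^ 3 * P
        + 18 * y.a * z.b * z.c * z.d * P + -54 * y.a * z.a * z.d ^ 2 * P + -27 * y.d ^ 2 * z.a ^ 2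
        + 18 * y.c * y.d * z.a * z.b + y.c ^ 2 * z.b ^ 2 + -12 * y.c ^ 2 * z.a * z.c + -12 * y.b * y.d * z.b ^ 2
        + 18 * y.b * y.d * z.a * z.c + 4 * y.b * y.c * z.b * z.c + 18 * y.b * y.c * z.a * z.d + y.b ^ 2 * z.c ^ 2
        + -12 * y.b ^ 2 * z.b * z.d + 18 * y.a * y.d * z.b * z.c + -108 * y.a * y.d * z.a * z.d
        + -12 * y.a * y.c * z.c ^ 2 + 18 * y.a * y.c * z.b * z.d + 18 * y.a * y.b * z.c * z.d
        + -27 * y.a ^ 2 * z.d ^ 2) := by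
  simp only [disc_eq, addMul, dot_grad, discDa, discDb, discDc, discDd]; ring

/-- In a ring where `P² = 0`: `Disc(y + P z) = Disc(y) + P ⟨∇Disc(y), z⟩`. [folklore] -/
theorem disc_addMul_of_sq_eq_zero (y z : BinaryCubic R) {P : R} (hP : P ^ 2 = 0) :
    (addMul y P z).disc = y.disc + P * dot (grad y) z := by
  rw [disc_addMul, hP, zero_mul, add_zero]

/-- `grad` commutes with change of ring. [folklore] -/
theorem grad_map {S : Type*} [CommRing S] (φ : R →+* S) (y : BinaryCubic R) :
    grad (y.map φ) = (grad y).map φ := by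
  ext <;> simp [grad, map, discDa, discDb, discDc, discDd, map_ofNat]

/-- `dot` commutes with change of ring. [folklore] -/
theorem dot_map {S : Type*} [CommRing S] (φ : R →+* S) (L z : BinaryCubic R) :
    dot (L.map φ) (z.map φ) = φ (dot L z) := by
  simp [dot, map]

end BinaryCubic

/-! ### Lifting `𝔽_p → ℤ/p²ℤ` by least residues; the fibre decomposition `y = ỹ₀ + p z̃` -/

section Lift

variable {p : ℕ} [hp : Fact p.Prime]

/-- `p²` is not zero. [folklore] -/
instance neZero_sq : NeZero (p ^ 2) := ⟨pow_ne_zero _ hp.out.ne_zero⟩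

/-- The least-residue lift `𝔽_p → ℤ/p²ℤ`, `t ↦ t.val`. [folklore] -/
def liftP (t : ZMod p) : ZMod (p ^ 2) := (t.val : ZMod (p ^ 2))

/-- Reduction mod `p`, `ℤ/p²ℤ → 𝔽_p`. [folklore] -/
def redP : ZMod (p ^ 2) →+* ZMod p := ZMod.castHom (dvd_pow_self p two_ne_zero) (ZMod p)

/-- `redP (liftP t) = t`. [folklore] -/
@[simp] theorem redP_liftP (t : ZMod p) : redP (liftP t) = t := by
  rw [redP, liftP, map_natCast, ZMod.natCast_zmod_val]

/-- `redP p = 0`. [folklore] -/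
@[simp] theorem redP_natCast_p : redP ((p : ZMod (p ^ 2))) = 0 := by
  rw [map_natCast, ZMod.natCast_self]

omit hp in
/-- `(p : ℤ/p²)² = 0`. [folklore] -/
theorem natCast_p_sq : ((p : ZMod (p ^ 2))) ^ 2 = 0 := by
  rw [← Nat.cast_pow, ZMod.natCast_self]

/-- `(liftP s + p · liftP t).val = s.val + p · t.val` (no carry: the sum is `< p²`). [folklore] -/
theorem val_liftP_add (s t : ZMod p) : (liftP s + (p : ZMod (p ^ 2)) * liftP t).val = s.val + p * t.val := by
  have hs := s.val_lt
  have ht := t.val_lt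
  have hlt : s.val + p * t.val < p ^ 2 := by
    have : p * t.val ≤ p * (p - 1) := Nat.mul_le_mul_left p (by omega)
    have hp1 : 1 ≤ p := hp.out.one_lt.le
    calc s.val + p * t.val < p + p * (p - 1) := by omega
      _ = p ^ 2 := by rw [Nat.mul_sub_one, ← Nat.add_sub_assoc (Nat.le_mul_self p), sq]; omega
  rw [liftP, liftP, show ((s.val : ZMod (p ^ 2)) + (p : ZMod (p ^ 2)) * (t.val : ZMod (p ^ 2)))
      = ((s.val + p * t.val : ℕ) : ZMod (p ^ 2)) by push_cast; ring, ZMod.val_natCast,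
    Nat.mod_eq_of_lt hlt]

/-- The pair map `(s, t) ↦ liftP s + p · liftP t` is injective. [folklore] -/
theorem liftP_add_injective :
    Function.Injective fun st : ZMod p × ZMod p => liftP st.1 + (p : ZMod (p ^ 2)) * liftP st.2 := by
  rintro ⟨s, t⟩ ⟨s', t'⟩ h
  have hv := congrArg ZMod.val h
  simp only [val_liftP_add] at hv
  have hpos : 0 < p := hp.out.pos
  have h1 : s.val = s'.val := by
    have := congrArg (· % p) hv
    simpa [Nat.add_mul_mod_self_left, Nat.mod_eq_of_lt s.val_lt, Nat.mod_eq_of_lt s'.val_lt] using this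
  have h2 : t.val = t'.val := by
    have : p * t.val = p * t'.val := by omega
    exact Nat.eq_of_mul_eq_mul_left hpos this
  exact Prod.ext (ZMod.val_injective p h1) (ZMod.val_injective p h2)

/-- The lifted form `ỹ₀` (coefficientwise least residues). [folklore] -/
def liftForm (y : BinaryCubic (ZMod p)) : BinaryCubic (ZMod (p ^ 2)) :=
  ⟨liftP y.a, liftP y.b, liftP y.c, liftP y.d⟩

/-- `ỹ₀ mod p = y₀`. [folklore] -/
@[simp] theorem liftForm_map_redP (y : BinaryCubic (ZMod p)) : (liftForm y).map redP = y := by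
  ext <;> simp [liftForm, BinaryCubic.map]

/-- The fibre decomposition map `(y₀, z) ↦ ỹ₀ + p z̃ ∈ V(ℤ/p²ℤ)`. [folklore] -/
def decomp (yz : BinaryCubic (ZMod p) × BinaryCubic (ZMod p)) : BinaryCubic (ZMod (p ^ 2)) :=
  BinaryCubic.addMul (liftForm yz.1) (p : ZMod (p ^ 2)) (liftForm yz.2)

/-- The fibre decomposition is injective. [folklore] -/
theorem decomp_injective : Function.Injective (decomp (p := p)) := by
  rintro ⟨y, z⟩ ⟨y', z'⟩ h
  have ha := congrArg BinaryCubic.a h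
  have hb := congrArg BinaryCubic.b h
  have hc := congrArg BinaryCubic.c h
  have hd := congrArg BinaryCubic.d h
  simp only [decomp, liftForm, BinaryCubic.addMul_a, BinaryCubic.addMul_b, BinaryCubic.addMul_c,
    BinaryCubic.addMul_d] at ha hb hc hd
  have ia := Prod.ext_iff.mp (liftP_add_injective (p := p) (a₁ := (y.a, z.a)) (a₂ := (y'.a, z'.a)) ha)
  have ib := Prod.ext_iff.mp (liftP_add_injective (p := p) (a₁ := (y.b, z.b)) (a₂ := (y'.b, z'.b)) hb)
  have ic := Prod.ext_iff.mp (liftP_add_injective (p := p) (a₁ := (y.c, z.c)) (a₂ := (y'.c, z'.c)) hc)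
  have id := Prod.ext_iff.mp (liftP_add_injective (p := p) (a₁ := (y.d, z.d)) (a₂ := (y'.d, z'.d)) hd)
  exact Prod.ext (BinaryCubic.ext ia.1 ib.1 ic.1 id.1) (BinaryCubic.ext ia.2 ib.2 ic.2 id.2)

/-- The fibre decomposition is a bijection `V(𝔽_p) × V(𝔽_p) ≃ V(ℤ/p²ℤ)` (both sides have `p⁸` elements). [folklore] -/
theorem decomp_bijective : Function.Bijective (decomp (p := p)) := by
  rw [Fintype.bijective_iff_injective_and_card]
  refine ⟨decomp_injective, ?_⟩
  rw [Fintype.card_prod, BinaryCubic.card_eq, BinaryCubic.card_eq, ZMod.card, ZMod.card]; ring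

/-- **`Σ_{y ∈ V(ℤ/p²ℤ)} F(y) = Σ_{y₀ ∈ V(𝔽_p)} Σ_{z ∈ V(𝔽_p)} F(ỹ₀ + p z̃)`.** [folklore] -/
theorem sum_decomp (F : BinaryCubic (ZMod (p ^ 2)) → ℂ) :
    ∑ y, F y = ∑ y₀ : BinaryCubic (ZMod p), ∑ z : BinaryCubic (ZMod p), F (decomp (y₀, z)) := by
  rw [← decomp_bijective.sum_comp F, Fintype.sum_prod_type]

/-! ### Multiples of `p` in `ℤ/p²ℤ`; the quotient `x/p mod p` -/

/-- `redP x = x.val mod p`. [folklore] -/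
theorem redP_eq_natCast_val (x : ZMod (p ^ 2)) : redP x = (x.val : ZMod p) := by
  rw [redP, ZMod.castHom_apply, ZMod.cast_eq_val]

/-- `redP x = 0 ↔ p ∣ x.val`. [folklore] -/
theorem redP_eq_zero_iff (x : ZMod (p ^ 2)) : redP x = 0 ↔ p ∣ x.val := by
  rw [redP_eq_natCast_val, ZMod.natCast_eq_zero_iff]

/-- **`p · x = 0` in `ℤ/p²ℤ` iff `x ≡ 0 (mod p)`.** [folklore] -/
theorem p_mul_eq_zero_iff (x : ZMod (p ^ 2)) : (p : ZMod (p ^ 2)) * x = 0 ↔ redP x = 0 := by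
  rw [redP_eq_zero_iff]
  have hx : (p : ZMod (p ^ 2)) * x = ((p * x.val : ℕ) : ZMod (p ^ 2)) := by
    push_cast; rw [ZMod.natCast_zmod_val]
  rw [hx, ZMod.natCast_eq_zero_iff]
  generalize x.val = n
  rw [sq]
  exact Nat.mul_dvd_mul_iff_left hp.out.pos

/-- `x/p mod p` for `x ∈ ℤ/p²ℤ` (meaningful when `p ∣ x`). [folklore] -/
def divP (x : ZMod (p ^ 2)) : ZMod p := ((x.val / p : ℕ) : ZMod p)

/-- If `x ≡ 0 (mod p)` then `x = p · lift(x/p)`. [folklore] -/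
theorem eq_p_mul_liftP_divP {x : ZMod (p ^ 2)} (h : redP x = 0) : x = (p : ZMod (p ^ 2)) * liftP (divP x) := by
  rw [redP_eq_zero_iff] at h
  have hlt : x.val / p < p := by
    rw [Nat.div_lt_iff_lt_mul hp.out.pos, ← sq]; exact x.val_lt
  rw [liftP, divP, ZMod.val_natCast, Nat.mod_eq_of_lt hlt, ← Nat.cast_mul, Nat.mul_div_cancel' h,
    ZMod.natCast_zmod_val]

/-- `liftP 0 = 0`. [folklore] -/
@[simp] theorem liftP_zero : liftP (0 : ZMod p) = 0 := by
  simp [liftP]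

/-- `divP 0 = 0`. [folklore] -/
@[simp] theorem divP_zero : divP (0 : ZMod (p ^ 2)) = 0 := by
  simp [divP]

/-! ### `Disc` on a fibre: `p² ∣ Disc(ỹ₀ + p z̃)` iff `Disc(y₀) = 0` and `D₁(y₀) + ⟨∇Disc(y₀), z⟩ = 0` -/

omit hp in
/-- **`Disc(ỹ₀ + p z̃) = Disc(ỹ₀) + p ⟨∇Disc(ỹ₀), z̃⟩` in `ℤ/p²ℤ`.** [folklore] -/
theorem disc_decomp (y₀ z : BinaryCubic (ZMod p)) :
    (decomp (y₀, z)).disc = (liftForm y₀).disc + (p : ZMod (p ^ 2)) * dot (grad (liftForm y₀)) (liftForm z) :=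
  disc_addMul_of_sq_eq_zero _ _ natCast_p_sq

/-- `Disc(ỹ₀) ≡ Disc(y₀) (mod p)`. [folklore] -/
theorem redP_disc_liftForm (y₀ : BinaryCubic (ZMod p)) : redP (liftForm y₀).disc = y₀.disc := by
  rw [← disc_map, liftForm_map_redP]

/-- `⟨∇Disc(ỹ₀), z̃⟩ ≡ ⟨∇Disc(y₀), z⟩ (mod p)`. [folklore] -/
theorem redP_dot_grad_liftForm (y₀ z : BinaryCubic (ZMod p)) :
    redP (dot (grad (liftForm y₀)) (liftForm z)) = dot (grad y₀) z := by
  rw [← dot_map, ← grad_map, liftForm_map_redP, liftForm_map_redP]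

/-- **The fibre criterion**: `p² ∣ Disc(ỹ₀ + p z̃)` iff `Disc(y₀) = 0` in `𝔽_p` and
`D₁(y₀) + ⟨∇Disc(y₀), z⟩ = 0` in `𝔽_p`, where `D₁(y₀) = Disc(ỹ₀)/p mod p`. [folklore] -/
theorem disc_decomp_eq_zero_iff (y₀ z : BinaryCubic (ZMod p)) :
    (decomp (y₀, z)).disc = 0 ↔ y₀.disc = 0 ∧ divP (liftForm y₀).disc + dot (grad y₀) z = 0 := by
  rw [disc_decomp]
  set T := (liftForm y₀).disc with hT
  set G := dot (grad (liftForm y₀)) (liftForm z) with hG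
  have hredG : redP G = dot (grad y₀) z := redP_dot_grad_liftForm y₀ z
  have hredT : redP T = y₀.disc := redP_disc_liftForm y₀
  constructor
  · intro h
    have h0 : y₀.disc = 0 := by
      have := congrArg redP h
      rwa [map_add, map_mul, redP_natCast_p, zero_mul, add_zero, map_zero, hredT] at this
    refine ⟨h0, ?_⟩
    have hT0 : redP T = 0 := hredT.trans h0
    rw [eq_p_mul_liftP_divP hT0, ← mul_add, p_mul_eq_zero_iff, map_add, redP_liftP, hredG] at h
    exact h
  · rintro ⟨h0, h1⟩
    have hT0 : redP T = 0 := hredT.trans h0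
    rw [eq_p_mul_liftP_divP hT0, ← mul_add, p_mul_eq_zero_iff, map_add, redP_liftP, hredG]
    exact h1

/-! ### The characters `e(·/p²)`, `e(·/p)` -/

section Characters

variable {m : ℕ} [NeZero m]

/-- `e` is a character: `e((s+t)/m) = e(s/m) e(t/m)`. [folklore] -/
theorem eMod_add (s t : ZMod m) : eMod (s + t) = eMod s * eMod t := by
  rw [eMod_eq_stdAddChar, eMod_eq_stdAddChar, eMod_eq_stdAddChar, AddChar.map_add_eq_mul]

/-- **`e(t/m) = 1` iff `t = 0`.** [folklore] -/
theorem eMod_eq_one_iff {t : ZMod m} : eMod t = 1 ↔ t = 0 := by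
  rw [eMod_eq_stdAddChar, ← (ZMod.stdAddChar (N := m)).map_zero_eq_one]
  exact ZMod.injective_stdAddChar.eq_iff

/-- **Orthogonality**: `Σ_{t ∈ ℤ/m} e(at/m) = m · [a = 0]`. [folklore] -/
theorem sum_eMod_mul (a : ZMod m) : ∑ t : ZMod m, eMod (a * t) = if a = 0 then (m : ℂ) else 0 := by
  have h := AddChar.sum_mulShift a (ZMod.isPrimitive_stdAddChar m)
  rw [ZMod.card, Nat.cast_ite, Nat.cast_zero] at h
  simp_rw [eMod_eq_stdAddChar, mul_comm a]
  exact h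

end Characters

/-- **`e(p·t/p²) = e(t/p)`**: the character of `ℤ/p²ℤ` on multiples of `p` is the character of `𝔽_p`. [folklore] -/
theorem eMod_p_mul (t : ZMod (p ^ 2)) : eMod ((p : ZMod (p ^ 2)) * t) = eMod (redP t) := by
  have hp0 : (p : ℂ) ≠ 0 := Nat.cast_ne_zero.mpr hp.out.ne_zero
  have hval : ((p : ZMod (p ^ 2)) * t).val = p * (t.val % p) := by
    rw [ZMod.val_mul, ZMod.val_natCast, Nat.mod_eq_of_lt (show p < p ^ 2 from lt_self_pow₀ hp.out.one_lt one_lt_two)]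
    generalize t.val = n
    rw [sq, Nat.mul_mod_mul_left]
  have hred : (redP t).val = t.val % p := by
    rw [redP_eq_natCast_val, ZMod.val_natCast]
  rw [eMod, eMod, hval, hred]
  congr 1
  push_cast
  field_simp

/-! ### Shintani's pairing on a fibre; the dual vector mod `p` -/

/-- The dual vector `ι⁻¹ f mod p = (d, −c/3, b/3, −a)` of an integral form `f` in the dual lattice. [cite: BhargavaTaniguchiThorne2023, §2.4 (the pairing [x, y] via ι)] -/
def dualVec (m : ℕ) (f : BinaryCubic ℤ) : BinaryCubic (ZMod m) :=
  ⟨(f.d : ZMod m), -((f.c / 3 : ℤ) : ZMod m), ((f.b / 3 : ℤ) : ZMod m), -(f.a : ZMod m)⟩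

/-- `⟨f, y⟩ = ⟨ι⁻¹ f, y⟩` (Shintani's pairing is the dot product with the dual vector). [folklore] -/
theorem dualPairing_eq_dot {m : ℕ} (f : BinaryCubic ℤ) (y : BinaryCubic (ZMod m)) :
    dualPairing f y = dot (dualVec m f) y := by
  simp only [dualPairing, dot, dualVec]; ring

/-- The pairing is compatible with reduction `ℤ/p² → 𝔽_p`. [folklore] -/
theorem redP_dualPairing (f : BinaryCubic ℤ) (y : BinaryCubic (ZMod (p ^ 2))) :
    redP (dualPairing f y) = dualPairing f (y.map redP) := by
  simp [dualPairing, BinaryCubic.map]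

omit hp in
/-- **`⟨f, ỹ₀ + p z̃⟩ = ⟨f, ỹ₀⟩ + p ⟨f, z̃⟩`** (bilinearity). [folklore] -/
theorem dualPairing_decomp (f : BinaryCubic ℤ) (y₀ z : BinaryCubic (ZMod p)) :
    dualPairing f (decomp (y₀, z)) = dualPairing f (liftForm y₀) + (p : ZMod (p ^ 2)) * dualPairing f (liftForm z) := by
  simp only [dualPairing, decomp, addMul_a, addMul_b, addMul_c, addMul_d, liftForm]; ring

/-- **`e(⟨f, ỹ₀ + p z̃⟩/p²) = e(⟨f, ỹ₀⟩/p²) · e(⟨f, z⟩/p)`.** [folklore] -/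
theorem eMod_dualPairing_decomp (f : BinaryCubic ℤ) (y₀ z : BinaryCubic (ZMod p)) :
    eMod (dualPairing f (decomp (y₀, z))) = eMod (dualPairing f (liftForm y₀)) * eMod (dualPairing f z) := by
  rw [dualPairing_decomp, eMod_add, eMod_p_mul, redP_dualPairing, liftForm_map_redP]

/-! ### `Ψ_{p²}` and the fibre-sum formula for its Fourier transform -/

/-- **`Ψ_{p²} = 𝟙_{p² ∣ Disc}` on `V(ℤ/p²ℤ)`** (BTT §5, the second definition of `Ψ_{p²}` for `p > 2`:
"nonmaximal at `p` or a triple root mod `p`" ⟺ "`p² ∣ Disc(x)`"). [cite: BhargavaTaniguchiThorne2023, §5 (Ψ_{p²}, second definition)] -/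
def psiLocal (p : ℕ) (y : BinaryCubic (ZMod (p ^ 2))) : ℂ := if y.disc = 0 then 1 else 0

/-- The hyperplane character sum `Σ_{z ∈ V(𝔽_p)} [c + ⟨L, z⟩ = 0] e(⟨w, z⟩/p)`. [folklore] -/
def hyperSum (w L : BinaryCubic (ZMod p)) (c : ZMod p) : ℂ :=
  ∑ z : BinaryCubic (ZMod p), if c + dot L z = 0 then eMod (dot w z) else 0

/-- **The fibre sum** `Z_f(y₀) = [Disc y₀ = 0] Σ_{z} [D₁(y₀) + ⟨∇Disc(y₀), z⟩ = 0] e(⟨f, z⟩/p)`. [folklore] -/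
def fibreSum (f : BinaryCubic ℤ) (y₀ : BinaryCubic (ZMod p)) : ℂ :=
  if y₀.disc = 0 then hyperSum (dualVec p f) (grad y₀) (divP (liftForm y₀).disc) else 0

/-- **`Σ_{y ∈ V(ℤ/p²)} Ψ_{p²}(y) e(⟨f, y⟩/p²) = Σ_{y₀ ∈ V(𝔽_p)} e(⟨f, ỹ₀⟩/p²) Z_f(y₀)`.** [folklore] -/
theorem sum_psiLocal_mul_eMod (f : BinaryCubic ℤ) :
    ∑ y : BinaryCubic (ZMod (p ^ 2)), psiLocal p y * eMod (dualPairing f y) =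
      ∑ y₀ : BinaryCubic (ZMod p), eMod (dualPairing f (liftForm y₀)) * fibreSum f y₀ := by
  rw [sum_decomp]
  refine Finset.sum_congr rfl fun y₀ _ => ?_
  rw [fibreSum]
  split_ifs with h0
  · rw [hyperSum, Finset.mul_sum]
    refine Finset.sum_congr rfl fun z _ => ?_
    rw [psiLocal]
    simp only [disc_decomp_eq_zero_iff, h0, true_and]
    split_ifs with h1
    · rw [one_mul, eMod_dualPairing_decomp, dualPairing_eq_dot f z]
    · rw [zero_mul, mul_zero]
  · rw [mul_zero]
    refine Finset.sum_eq_zero fun z _ => ?_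
    rw [psiLocal, if_neg, zero_mul]
    rw [disc_decomp_eq_zero_iff]
    exact fun h => h0 h.1

/-- **`Ψ̂_{p²}(ι⁻¹ f) = p⁻⁸ Σ_{y₀} e(⟨f, ỹ₀⟩/p²) Z_f(y₀)`.** [cite: BhargavaTaniguchiThorne2023, §2.4 (eq:FT) with §5 (Ψ_{p²})] -/
theorem fourierDual_psiLocal_eq (f : BinaryCubic ℤ) :
    fourierDual (psiLocal p) f =
      (((p : ℂ) ^ 2) ^ 4)⁻¹ * ∑ y₀ : BinaryCubic (ZMod p), eMod (dualPairing f (liftForm y₀)) * fibreSum f y₀ := by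
  rw [fourierDual_eq_sum, sum_psiLocal_mul_eMod]; push_cast; ring

/-! ### The hyperplane lemma -/

/-- Translation by `v` on `V(𝔽_p)`. [folklore] -/
def addShift (v : BinaryCubic (ZMod p)) : BinaryCubic (ZMod p) ≃ BinaryCubic (ZMod p) where
  toFun z := ⟨z.a + v.a, z.b + v.b, z.c + v.c, z.d + v.d⟩
  invFun z := ⟨z.a - v.a, z.b - v.b, z.c - v.c, z.d - v.d⟩
  left_inv z := by ext <;> simp
  right_inv z := by ext <;> simp

/-- `dot` is additive in the second variable along a shift. [folklore] -/
theorem dot_addShift (L v z : BinaryCubic (ZMod p)) : dot L (addShift v z) = dot L z + dot L v := by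
  simp only [dot, addShift, Equiv.coe_fn_mk]; ring

/-- **The hyperplane lemma**: if `⟨L, v⟩ = 0` but `⟨w, v⟩ ≠ 0` for some `v`, then
`Σ_{z} [c + ⟨L, z⟩ = 0] e(⟨w, z⟩/p) = 0` (shift `z ↦ z + v`). [folklore] -/
theorem hyperSum_eq_zero_of_shift {w L v : BinaryCubic (ZMod p)} (c : ZMod p) (hL : dot L v = 0)
    (hw : dot w v ≠ 0) : hyperSum w L c = 0 := by
  have hne : eMod (dot w v) ≠ 1 := fun h => hw (eMod_eq_one_iff.mp h)
  have key : hyperSum w L c = eMod (dot w v) * hyperSum w L c := by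
    unfold hyperSum
    conv_lhs => rw [← (addShift v).sum_comp]
    rw [Finset.mul_sum]
    refine Finset.sum_congr rfl fun z _ => ?_
    simp only [dot_addShift, hL, add_zero]
    split_ifs
    · rw [eMod_add, mul_comm]
    · rw [mul_zero]
  have : (1 - eMod (dot w v)) * hyperSum w L c = 0 := by
    rw [sub_mul, one_mul, ← key, sub_self]
  rcases mul_eq_zero.mp this with h | h
  · exact absurd (sub_eq_zero.mp h).symm hne
  · exact h

/-! ### Sums over `V(𝔽_p)` coordinate by coordinate -/

/-- `Σ_{z ∈ V(R)} F(z_a, z_b, z_c, z_d) = Σ_a Σ_b Σ_c Σ_d F(a, b, c, d)`. [folklore] -/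
theorem sum_binaryCubic {R M : Type*} [Fintype R] [AddCommMonoid M] (F : R → R → R → R → M) :
    ∑ z : BinaryCubic R, F z.a z.b z.c z.d = ∑ a : R, ∑ b : R, ∑ c : R, ∑ d : R, F a b c d := by
  rw [← equivProd.symm.sum_comp, Fintype.sum_prod_type, Finset.sum_congr rfl]
  intro a _
  rw [Fintype.sum_prod_type, Finset.sum_congr rfl]
  intro b _
  rw [Fintype.sum_prod_type]
  rfl

/-- `#{z ∈ V(𝔽_p) : z_a = 0} = p³`, as a character-free sum. [folklore] -/
theorem sum_ite_a_eq_zero : ∑ z : BinaryCubic (ZMod p), (if z.a = 0 then (1 : ℂ) else 0) = (p : ℂ) ^ 3 := by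
  rw [sum_binaryCubic (fun a _ _ _ => if a = 0 then (1 : ℂ) else 0)]
  have inner : ∀ a : ZMod p, (∑ _b : ZMod p, ∑ _c : ZMod p, ∑ _d : ZMod p, if a = 0 then (1 : ℂ) else 0)
      = (p : ℂ) ^ 3 * (if a = 0 then 1 else 0) := by
    intro a
    simp only [Finset.sum_const, Finset.card_univ, ZMod.card, nsmul_eq_mul]
    ring
  rw [Finset.sum_congr rfl (fun a _ => inner a), ← Finset.mul_sum, Finset.sum_ite_eq' Finset.univ (0 : ZMod p)]
  simp

/-! ### The normal form `p ∣ a, b, c`, `p ∤ d`: only `y₀ = (0, 0, c₀, d₀)`, `c₀ ≠ 0`, contribute -/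

/-- `4 ≠ 0` in `𝔽_p` for `p ≥ 5`. [folklore] -/
theorem four_ne_zero_zmod (hp5 : 5 ≤ p) : (4 : ZMod p) ≠ 0 := by
  intro h
  have h' : ((4 : ℕ) : ZMod p) = 0 := by exact_mod_cast h
  rw [ZMod.natCast_eq_zero_iff] at h'
  have := Nat.le_of_dvd (by norm_num) h'
  omega

/-- For `p ≥ 5`: `p ∣ 3k ⇒ p ∣ k`. [folklore] -/
theorem dvd_of_dvd_three_mul (hp5 : 5 ≤ p) {k : ℤ} (h : (p : ℤ) ∣ 3 * k) : (p : ℤ) ∣ k := by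
  have hpr : Prime (p : ℤ) := Nat.prime_iff_prime_int.mp hp.out
  rcases hpr.dvd_or_dvd h with h3 | hk
  · exfalso
    have := Int.le_of_dvd (by norm_num) h3
    omega
  · exact hk

/-- **Step A (hyperplane lemma in the normal form).** If the dual vector of `f` mod `p` is `(δ, 0, 0, 0)`
with `δ ≠ 0` and the fibre sum at `y₀` is nonzero, then `Disc(y₀) = 0`, `∂_b = ∂_c = ∂_d = 0` and `∂_a ≠ 0`
at `y₀`. [folklore] -/
theorem fibreSum_ne_zero_normalForm {f : BinaryCubic ℤ} {δ : ZMod p} (hf : dualVec p f = ⟨δ, 0, 0, 0⟩) (hδ : δ ≠ 0)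
    {y₀ : BinaryCubic (ZMod p)} (h : fibreSum f y₀ ≠ 0) :
    y₀.disc = 0 ∧ (grad y₀).b = 0 ∧ (grad y₀).c = 0 ∧ (grad y₀).d = 0 ∧ (grad y₀).a ≠ 0 := by
  unfold fibreSum at h
  by_cases h0 : y₀.disc = 0
  · rw [if_pos h0, hf] at h
    set L := grad y₀
    set c := divP (liftForm y₀).disc
    have van : ∀ v : BinaryCubic (ZMod p), dot L v = 0 → dot ⟨δ, 0, 0, 0⟩ v ≠ 0 → False :=
      fun v hL hw => h (hyperSum_eq_zero_of_shift c hL hw)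
    have hb : L.b = 0 := by
      by_contra hb
      exact van ⟨L.b, -L.a, 0, 0⟩ (by simp only [dot]; ring) (by simpa [dot] using mul_ne_zero hδ hb)
    have hc : L.c = 0 := by
      by_contra hc
      exact van ⟨L.c, 0, -L.a, 0⟩ (by simp only [dot]; ring) (by simpa [dot] using mul_ne_zero hδ hc)
    have hd : L.d = 0 := by
      by_contra hd
      exact van ⟨L.d, 0, 0, -L.a⟩ (by simp only [dot]; ring) (by simpa [dot] using mul_ne_zero hδ hd)
    have ha : L.a ≠ 0 := by
      intro ha
      exact van ⟨1, 0, 0, 0⟩ (by simp only [dot, ha, hb, hc, hd]; ring) (by simpa [dot] using hδ)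
    exact ⟨h0, hb, hc, hd, ha⟩
  · rw [if_neg h0] at h
    exact absurd rfl h

/-- **Step B (Euler).** Over `𝔽_p`, `p ≥ 5`: `Disc(y) = 0`, `∂_b = ∂_c = ∂_d = 0`, `∂_a ≠ 0` force
`y = (0, 0, c, d)` with `c ≠ 0` (`a ∂_a = 4 Disc − b ∂_b − c ∂_c − d ∂_d = 0`, then `∂_d = −4b³`, `∂_a = −4c³`). [folklore] -/
theorem a_eq_zero_of_grad (hp5 : 5 ≤ p) {y : BinaryCubic (ZMod p)} (h0 : y.disc = 0) (hb : (grad y).b = 0)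
    (hc : (grad y).c = 0) (hd : (grad y).d = 0) (ha : (grad y).a ≠ 0) : y.a = 0 ∧ y.b = 0 ∧ y.c ≠ 0 := by
  have h4 := four_ne_zero_zmod hp5
  have euler := dot_grad_self y
  rw [h0, mul_zero, dot] at euler
  rw [hb, hc, hd, zero_mul, zero_mul, zero_mul, add_zero, add_zero, add_zero] at euler
  have hya : y.a = 0 := (mul_eq_zero.mp euler).resolve_left ha
  have hyb : y.b = 0 := by
    have : (grad y).d = -4 * y.b ^ 3 := by
      show y.discDd = _; simp only [discDd, hya]; ring
    rw [this, neg_mul, neg_eq_zero, mul_eq_zero] at hd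
    exact pow_eq_zero_iff (n := 3) (by norm_num) |>.mp (hd.resolve_left h4)
  have hyc : y.c ≠ 0 := by
    intro hyc
    apply ha
    show y.discDa = 0
    simp only [discDa, hya, hyb, hyc]; ring
  exact ⟨hya, hyb, hyc⟩

/-- **Step C.** At `y₀ = (0, 0, c₀, d₀)`, `c₀ ≠ 0`, in the normal form the fibre sum is `p³`
(`∇Disc(y₀) = (−4c₀³, 0, 0, 0)`, `Disc(ỹ₀) = 0`, and the `z` with `z_a = 0` each contribute `e(0) = 1`). [folklore] -/
theorem fibreSum_normalForm_eq (hp5 : 5 ≤ p) {f : BinaryCubic ℤ} {δ : ZMod p} (hf : dualVec p f = ⟨δ, 0, 0, 0⟩)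
    {c₀ d₀ : ZMod p} (hc₀ : c₀ ≠ 0) : fibreSum f ⟨0, 0, c₀, d₀⟩ = (p : ℂ) ^ 3 := by
  have h4 := four_ne_zero_zmod hp5
  have hdisc : (⟨0, 0, c₀, d₀⟩ : BinaryCubic (ZMod p)).disc = 0 := by simp [disc_eq]
  have hlift : liftForm (⟨0, 0, c₀, d₀⟩ : BinaryCubic (ZMod p)) = ⟨0, 0, liftP c₀, liftP d₀⟩ := by
    simp [liftForm]
  have hdisc2 : (liftForm (⟨0, 0, c₀, d₀⟩ : BinaryCubic (ZMod p))).disc = 0 := by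
    rw [hlift]; simp [disc_eq]
  have hgrad : grad (⟨0, 0, c₀, d₀⟩ : BinaryCubic (ZMod p)) = ⟨-4 * c₀ ^ 3, 0, 0, 0⟩ := by
    ext <;> simp [grad, discDa, discDb, discDc, discDd]
  have hcoef : (-4 * c₀ ^ 3 : ZMod p) ≠ 0 := mul_ne_zero (neg_ne_zero.mpr h4) (pow_ne_zero 3 hc₀)
  rw [fibreSum, if_pos hdisc, hdisc2, divP_zero, hgrad, hf, hyperSum, ← sum_ite_a_eq_zero]
  refine Finset.sum_congr rfl fun z _ => ?_
  simp only [dot, zero_mul, add_zero, zero_add, mul_eq_zero, hcoef, false_or]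
  by_cases hz : z.a = 0
  · simp [hz]
  · simp [hz]

/-- The pairing with `ỹ₀` for `y₀ = (0, 0, c, d)`, in the normal form `b/3 = pβ`, `a = pα`:
`e(⟨f, ỹ₀⟩/p²) = e((βc − αd)/p)`. [folklore] -/
theorem eMod_dualPairing_liftForm_zero_zero {f : BinaryCubic ℤ} {α β : ℤ} (hα : f.a = p * α) (hβ : f.b / 3 = p * β)
    (c d : ZMod p) :
    eMod (dualPairing f (liftForm (⟨0, 0, c, d⟩ : BinaryCubic (ZMod p)))) =
      eMod ((β : ZMod p) * c) * eMod (-(α : ZMod p) * d) := by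
  have hlift : liftForm (⟨0, 0, c, d⟩ : BinaryCubic (ZMod p)) = ⟨0, 0, liftP c, liftP d⟩ := by simp [liftForm]
  have hpair : dualPairing f (⟨0, 0, liftP c, liftP d⟩ : BinaryCubic (ZMod (p ^ 2))) =
      (p : ZMod (p ^ 2)) * ((β : ZMod (p ^ 2)) * liftP c + -(α : ZMod (p ^ 2)) * liftP d) := by
    simp only [dualPairing, hβ, hα]; push_cast; ring
  rw [hlift, hpair, eMod_p_mul, map_add, map_mul, map_mul, map_neg, map_intCast, map_intCast, redP_liftP, redP_liftP,
    eMod_add]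

/-- `Σ_{c ≠ 0} e(βc/p) = p[β = 0] − 1`. [folklore] -/
theorem sum_ne_zero_eMod_mul (β : ZMod p) :
    ∑ c : ZMod p, (if c ≠ 0 then eMod (β * c) else 0) = (if β = 0 then (p : ℂ) else 0) - 1 := by
  rw [← sum_eMod_mul β, ← Finset.sum_erase_add _ _ (Finset.mem_univ (0 : ZMod p)),
    ← Finset.sum_erase_add Finset.univ (fun c => eMod (β * c)) (Finset.mem_univ (0 : ZMod p))]
  simp only [ne_eq, not_true_eq_false, if_false, add_zero, mul_zero, eMod_zero, add_sub_cancel_right]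
  exact Finset.sum_congr rfl fun c hc => by rw [if_pos (Finset.ne_of_mem_erase hc)]

/-- **The Fourier transform of `Ψ_{p²}` in the normal form** (`p ≥ 5`; `f` in the dual lattice with
`p ∣ a, b, c`, `p ∤ d`): `Ψ̂_{p²}(ι⁻¹ f) = [p² ∣ a] · (p⁻³ [p² ∣ b] − p⁻⁴)`. In particular the transform
vanishes when `p ∥ a`, equals `−p⁻⁴` when `p² ∣ a`, `p ∥ b`, and `p⁻³ − p⁻⁴` when `p² ∣ a`, `p² ∣ b`
(BTT Prop. 5.2: "Divisible by `p²`: … `O(p⁻⁵)`" — here `0`; "Divisible by `p³`: `O(p⁻⁴)`"; "Divisible by `p⁴`: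
`O(p⁻³)`", for the second definition of `Ψ`). [cite: BhargavaTaniguchiThorne2023, Prop. 5.2] -/
theorem fourierDual_psiLocal_normalForm (hp5 : 5 ≤ p) {f : BinaryCubic ℤ} (h3b : (3 : ℤ) ∣ f.b) (h3c : (3 : ℤ) ∣ f.c)
    (ha : (p : ℤ) ∣ f.a) (hb : (p : ℤ) ∣ f.b) (hc : (p : ℤ) ∣ f.c) (hd : ¬ (p : ℤ) ∣ f.d) :
    fourierDual (psiLocal p) f =
      if (p : ℤ) ^ 2 ∣ f.a then (if (p : ℤ) ^ 2 ∣ f.b then ((p : ℂ) ^ 3)⁻¹ - ((p : ℂ) ^ 4)⁻¹ else -((p : ℂ) ^ 4)⁻¹)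
      else 0 := by
  have hp0 : (p : ℤ) ≠ 0 := Nat.cast_ne_zero.mpr hp.out.ne_zero
  have hpC : (p : ℂ) ≠ 0 := Nat.cast_ne_zero.mpr hp.out.ne_zero
  obtain ⟨α, hα⟩ := ha
  have hb3 : (p : ℤ) ∣ f.b / 3 := dvd_of_dvd_three_mul hp5 (by rwa [Int.mul_ediv_cancel' h3b])
  have hc3 : (p : ℤ) ∣ f.c / 3 := dvd_of_dvd_three_mul hp5 (by rwa [Int.mul_ediv_cancel' h3c])
  obtain ⟨β, hβ⟩ := hb3
  set δ : ZMod p := (f.d : ZMod p) with hδdef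
  have hδ : δ ≠ 0 := by rwa [hδdef, Ne, ZMod.intCast_zmod_eq_zero_iff_dvd]
  have hw : dualVec p f = ⟨δ, 0, 0, 0⟩ := by
    refine BinaryCubic.ext rfl ?_ ?_ ?_
    · show -((f.c / 3 : ℤ) : ZMod p) = 0
      rw [neg_eq_zero, ZMod.intCast_zmod_eq_zero_iff_dvd]; exact hc3
    · show ((f.b / 3 : ℤ) : ZMod p) = 0
      rw [ZMod.intCast_zmod_eq_zero_iff_dvd, hβ]; exact dvd_mul_right _ _
    · show -(f.a : ZMod p) = 0
      rw [neg_eq_zero, ZMod.intCast_zmod_eq_zero_iff_dvd, hα]; exact dvd_mul_right _ _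
  -- the divisibility conditions in terms of `α`, `β`
  have hdiva : (p : ℤ) ^ 2 ∣ f.a ↔ ((α : ZMod p)) = 0 := by
    rw [ZMod.intCast_zmod_eq_zero_iff_dvd, hα, sq, mul_dvd_mul_iff_left hp0]
  have hdivb : (p : ℤ) ^ 2 ∣ f.b ↔ ((β : ZMod p)) = 0 := by
    rw [ZMod.intCast_zmod_eq_zero_iff_dvd, ← Int.mul_ediv_cancel' h3b, hβ, sq]
    constructor
    · intro h
      have h' : (p : ℤ) * p ∣ (p : ℤ) * (3 * β) := by convert h using 1; ring
      exact dvd_of_dvd_three_mul hp5 ((mul_dvd_mul_iff_left hp0).mp h')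
    · intro h
      have : (p : ℤ) * p ∣ (p : ℤ) * (3 * β) := (mul_dvd_mul_iff_left hp0).mpr (dvd_mul_of_dvd_right h 3)
      convert this using 1; ring
  -- only `y₀ = (0, 0, c, d)`, `c ≠ 0`, contribute, each with fibre sum `p³`
  have hsum : ∑ y₀ : BinaryCubic (ZMod p), eMod (dualPairing f (liftForm y₀)) * fibreSum f y₀ =
      ∑ y₀ : BinaryCubic (ZMod p), (if y₀.a = 0 ∧ y₀.b = 0 ∧ y₀.c ≠ 0 then
        eMod (dualPairing f (liftForm ⟨y₀.a, y₀.b, y₀.c, y₀.d⟩)) * (p : ℂ) ^ 3 else 0) := by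
    refine Finset.sum_congr rfl fun y₀ _ => ?_
    split_ifs with hy
    · obtain ⟨h1, h2, h3⟩ := hy
      have : y₀ = ⟨0, 0, y₀.c, y₀.d⟩ := BinaryCubic.ext h1 h2 rfl rfl
      rw [this, fibreSum_normalForm_eq hp5 hw h3]
    · by_contra hne
      have hne' : fibreSum f y₀ ≠ 0 := fun h0 => hne (by rw [h0, mul_zero])
      obtain ⟨h0, hb', hc', hd', ha'⟩ := fibreSum_ne_zero_normalForm hw hδ hne'
      exact hy (a_eq_zero_of_grad hp5 h0 hb' hc' hd' ha')
  have hsum2 : ∑ y₀ : BinaryCubic (ZMod p), (if y₀.a = 0 ∧ y₀.b = 0 ∧ y₀.c ≠ 0 then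
        eMod (dualPairing f (liftForm ⟨y₀.a, y₀.b, y₀.c, y₀.d⟩)) * (p : ℂ) ^ 3 else 0) =
      (p : ℂ) ^ 3 * (((if (β : ZMod p) = 0 then (p : ℂ) else 0) - 1) * (if (α : ZMod p) = 0 then (p : ℂ) else 0)) := by
    rw [sum_binaryCubic (fun a b c d => if a = 0 ∧ b = 0 ∧ c ≠ 0 then
        eMod (dualPairing f (liftForm ⟨a, b, c, d⟩)) * (p : ℂ) ^ 3 else 0)]
    rw [Finset.sum_eq_single (0 : ZMod p) (fun a _ ha => by simp [ha]) (fun h => absurd (Finset.mem_univ _) h)]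
    rw [Finset.sum_eq_single (0 : ZMod p) (fun b _ hb => by simp [hb]) (fun h => absurd (Finset.mem_univ _) h)]
    simp only [true_and]
    simp_rw [eMod_dualPairing_liftForm_zero_zero hα hβ]
    have hd : ∀ c : ZMod p, ∑ d : ZMod p, (if c ≠ 0 then eMod ((β : ZMod p) * c) * eMod (-(α : ZMod p) * d) * (p : ℂ) ^ 3 else 0)
        = (p : ℂ) ^ 3 * (if c ≠ 0 then eMod ((β : ZMod p) * c) else 0) * (if (α : ZMod p) = 0 then (p : ℂ) else 0) := by
      intro c
      by_cases hc0 : c = 0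
      · simp [hc0]
      · simp only [hc0, ne_eq, not_false_eq_true, if_true]
        rw [show (∑ d : ZMod p, eMod ((β : ZMod p) * c) * eMod (-(α : ZMod p) * d) * (p : ℂ) ^ 3)
            = eMod ((β : ZMod p) * c) * (p : ℂ) ^ 3 * ∑ d : ZMod p, eMod (-(α : ZMod p) * d) by
            rw [Finset.mul_sum]; exact Finset.sum_congr rfl fun d _ => by ring,
          sum_eMod_mul]
        by_cases hα0 : (α : ZMod p) = 0
        · rw [if_pos (by rw [hα0, neg_zero]), if_pos hα0]; ring
        · rw [if_neg (by rwa [neg_eq_zero]), if_neg hα0]; ring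
    rw [Finset.sum_congr rfl (fun c _ => hd c), ← Finset.sum_mul, ← Finset.mul_sum, sum_ne_zero_eMod_mul]
    ring
  rw [fourierDual_psiLocal_eq, hsum, hsum2]
  by_cases hA : (p : ℤ) ^ 2 ∣ f.a
  · have hα0 : (α : ZMod p) = 0 := hdiva.mp hA
    by_cases hB : (p : ℤ) ^ 2 ∣ f.b
    · have hβ0 : (β : ZMod p) = 0 := hdivb.mp hB
      rw [if_pos hA, if_pos hB, if_pos hα0, if_pos hβ0]
      field_simp
    · have hβ0 : (β : ZMod p) ≠ 0 := fun h => hB (hdivb.mpr h)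
      rw [if_pos hA, if_neg hB, if_pos hα0, if_neg hβ0]
      field_simp
      ring
  · have hα0 : (α : ZMod p) ≠ 0 := fun h => hA (hdiva.mpr h)
    rw [if_neg hA, if_neg hα0]
    ring

end Lift

end Literature.NumberTheory.CubicFields

end
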